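import Mathlib
import HarnessLib
import Summits.MatrixMultiplication.Statement
import Summits.MatrixMultiplication.MatrixMultiplication.Theses.IsotypicSaturation
import Literature.Computability.AlgebraicComplexity.StrassenSpectralTheorem
import Literature.Computability.AlgebraicComplexity.IsotypicOccurrenceSemigroup

/-!
# Line `kernel-image-split` — crux `PolytopeSaturation` (stmt-MatrixMultiplication-4417)

Kernel/image factorisation of the monotonicity statement `PolytopeSaturation`
(`Δ(s) ⊆ Δ(t) ⇒ F s ≤ F t` for every universal spectral point `F`, `Δ` = moment polytope read
through occurring partition triples):

* `stub_polytopeInvariance` — piece `PolytopeInvariance`: `F` is constant on the fibres of `Δ`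
  (`Δ(s) = Δ(t) ⇒ F s = F t`);
* `stub_dominationLifting` — piece `DominationLifting`: polytope inclusion lifts to Strassen's
  asymptotic preorder modulo polytope-equivalence
  (`Δ(s) ⊆ Δ(t) ⇒ ∃ s₁ t₁, Δ(s₁) = Δ(s) ∧ Δ(t₁) = Δ(t) ∧ [s₁] ≲ [t₁]`, `AsympLe` on `TensorClass ℂ`).

`PolytopeSaturation_of`: `F s = F s₁`, `F t₁ = F t` (invariance) and `F s₁ ≤ F t₁` (easy half of
Strassen's spectral theorem: `[s₁]^N ≤ f(N)·[t₁]^N`, `f` subexponential, read through the monotone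
semiring homomorphism `eval F : T(ℂ) → ℝ`, forces `F(s₁)^N ≤ f(N) F(t₁)^N`, hence `F s₁ ≤ F t₁`).
Conversely `PolytopeSaturation` implies both stubs (the second by the HARD half of Strassen's
theorem), so the factorisation is exact: `PolytopeSaturation ⟺ stub₁ ∧ stub₂`.
The two stubs are filed as the route's new crux items by `route edit --split PolytopeSaturation`.
-/

set_option linter.dupNamespace false

namespace Summit.MatrixMultiplication.MatrixMultiplication.Cruxes.PolytopeSaturation.KernelImageSplit

open Summit.MatrixMultiplication.MatrixMultiplication.Theses.IsotypicSaturation (PolytopeSaturation)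

/-- **stub 1** — piece `PolytopeInvariance`: universal spectral points are constant on
moment-polytope fibres (route item after the split). -/
theorem stub_polytopeInvariance :
    ∀ F : Literature.Computability.AlgebraicComplexity.SpectralMap ℂ, Literature.Computability.AlgebraicComplexity.IsUniversalSpectralPoint ℂ F → ∀ {ι κ μ ι' κ' μ' : Type} [Fintype ι] [Fintype κ] [Fintype μ] [Fintype ι'] [Fintype κ'] [Fintype μ'] (s : ι → κ → μ → ℂ) (t : ι' → κ' → μ' → ℂ), (∀ (n : ℕ) (lam : Fin 3 → Nat.Partition n), 0 < n → Literature.Computability.AlgebraicComplexity.isotypicSum₁ (lam 0) (Literature.Computability.AlgebraicComplexity.isotypicSum₂ (lam 1) (Literature.Computability.AlgebraicComplexity.isotypicSum₃ (lam 2) (Literature.Computability.AlgebraicComplexity.kroneckerPow s n))) ≠ 0 → ∃ (k : ℕ) (mu : Fin 3 → Nat.Partition (k * n)), 0 < k ∧ (∀ j, (mu j).parts = (lam j).parts.map (fun p => k * p)) ∧ Literature.Computability.AlgebraicComplexity.isotypicSum₁ (mu 0) (Literature.Computability.AlgebraicComplexity.isotypicSum₂ (mu 1) (Literature.Computability.AlgebraicComplexity.isotypicSum₃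 (mu 2) (Literature.Computability.AlgebraicComplexity.kroneckerPow t (k * n)))) ≠ 0) → (∀ (n : ℕ) (lam : Fin 3 → Nat.Partition n), 0 < n → Literature.Computability.AlgebraicComplexity.isotypicSum₁ (lam 0) (Literature.Computability.AlgebraicComplexity.isotypicSum₂ (lam 1) (Literature.Computability.AlgebraicComplexity.isotypicSum₃ (lam 2) (Literature.Computability.AlgebraicComplexity.kroneckerPow t n))) ≠ 0 → ∃ (k : ℕ) (mu : Fin 3 → Nat.Partition (k * n)), 0 < k ∧ (∀ j, (mu j).parts = (lam j).parts.map (fun p => k * p)) ∧ Literature.Computability.AlgebraicComplexity.isotypicSum₁ (mu 0) (Literature.Computability.AlgebraicComplexity.isotypicSum₂ (mu 1) (Literature.Computability.AlgebraicComplexity.isotypicSum₃ (mu 2) (Literature.Computability.AlgebraicComplexity.kroneckerPow s (k * n)))) ≠ 0) → F s = F t := by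
  sorry

/-- **stub 2** — piece `DominationLifting`: polytope domination lifts to the asymptotic preorder
between polytope-twins (route item after the split). -/
theorem stub_dominationLifting :
    ∀ {ι κ μ ι' κ' μ' : Type} [Fintype ι] [Fintype κ] [Fintype μ] [Fintype ι'] [Fintype κ'] [Fintype μ'] (s : ι → κ → μ → ℂ) (t : ι' → κ' → μ' → ℂ), (∀ (n : ℕ) (lam : Fin 3 → Nat.Partition n), 0 < n → Literature.Computability.AlgebraicComplexity.isotypicSum₁ (lam 0) (Literature.Computability.AlgebraicComplexity.isotypicSum₂ (lam 1) (Literature.Computability.AlgebraicComplexity.isotypicSum₃ (lam 2) (Literature.Computability.AlgebraicComplexity.kroneckerPow s n))) ≠ 0 → ∃ (k : ℕ) (mu : Fin 3 → Nat.Partition (k * n)), 0 < k ∧ (∀ j, (mu j).parts = (lam j).parts.map (fun p => k * p)) ∧ Literature.Computability.AlgebraicComplexity.isotypicSum₁ (mu 0) (Literature.Computability.AlgebraicComplexity.isotypicSum₂ (mu 1) (Literature.Computability.AlgebraicComplexity.isotypicSum₃ (mu 2) (Literature.Computability.AlgebraicComplexity.kroneckerPow t (k * n)))) ≠ 0) →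 ∃ (ι₁ κ₁ μ₁ ι₂ κ₂ μ₂ : Type) (_ : Fintype ι₁) (_ : Fintype κ₁) (_ : Fintype μ₁) (_ : Fintype ι₂) (_ : Fintype κ₂) (_ : Fintype μ₂) (s₁ : ι₁ → κ₁ → μ₁ → ℂ) (t₁ : ι₂ → κ₂ → μ₂ → ℂ), (∀ (n : ℕ) (lam : Fin 3 → Nat.Partition n), 0 < n → Literature.Computability.AlgebraicComplexity.isotypicSum₁ (lam 0) (Literature.Computability.AlgebraicComplexity.isotypicSum₂ (lam 1) (Literature.Computability.AlgebraicComplexity.isotypicSum₃ (lam 2) (Literature.Computability.AlgebraicComplexity.kroneckerPow s n))) ≠ 0 → ∃ (k : ℕ) (mu : Fin 3 → Nat.Partition (k * n)), 0 < k ∧ (∀ j, (mu j).parts = (lam j).parts.map (fun p => k * p)) ∧ Literature.Computability.AlgebraicComplexity.isotypicSum₁ (mu 0) (Literature.Computability.AlgebraicComplexity.isotypicSum₂ (mu 1) (Literature.Computability.AlgebraicComplexity.isotypicSum₃ (mu 2) (Literature.Computability.AlgebraicComplexity.kroneckerPow s₁ (k * n)))) ≠ 0) ∧ (∀ (n : ℕ)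 (lam : Fin 3 → Nat.Partition n), 0 < n → Literature.Computability.AlgebraicComplexity.isotypicSum₁ (lam 0) (Literature.Computability.AlgebraicComplexity.isotypicSum₂ (lam 1) (Literature.Computability.AlgebraicComplexity.isotypicSum₃ (lam 2) (Literature.Computability.AlgebraicComplexity.kroneckerPow s₁ n))) ≠ 0 → ∃ (k : ℕ) (mu : Fin 3 → Nat.Partition (k * n)), 0 < k ∧ (∀ j, (mu j).parts = (lam j).parts.map (fun p => k * p)) ∧ Literature.Computability.AlgebraicComplexity.isotypicSum₁ (mu 0) (Literature.Computability.AlgebraicComplexity.isotypicSum₂ (mu 1) (Literature.Computability.AlgebraicComplexity.isotypicSum₃ (mu 2) (Literature.Computability.AlgebraicComplexity.kroneckerPow s (k * n)))) ≠ 0) ∧ (∀ (n : ℕ) (lam : Fin 3 → Nat.Partition n), 0 < n → Literature.Computability.AlgebraicComplexity.isotypicSum₁ (lam 0) (Literature.Computability.AlgebraicComplexity.isotypicSum₂ (lam 1) (Literature.Computability.AlgebraicComplexity.isotypicSum₃ (lam 2) (Literature.Computability.AlgebraicComplexity.kroneckerPow t n))) ≠ 0 → ∃ (k : ℕ) (mu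 : Fin 3 → Nat.Partition (k * n)), 0 < k ∧ (∀ j, (mu j).parts = (lam j).parts.map (fun p => k * p)) ∧ Literature.Computability.AlgebraicComplexity.isotypicSum₁ (mu 0) (Literature.Computability.AlgebraicComplexity.isotypicSum₂ (mu 1) (Literature.Computability.AlgebraicComplexity.isotypicSum₃ (mu 2) (Literature.Computability.AlgebraicComplexity.kroneckerPow t₁ (k * n)))) ≠ 0) ∧ (∀ (n : ℕ) (lam : Fin 3 → Nat.Partition n), 0 < n → Literature.Computability.AlgebraicComplexity.isotypicSum₁ (lam 0) (Literature.Computability.AlgebraicComplexity.isotypicSum₂ (lam 1) (Literature.Computability.AlgebraicComplexity.isotypicSum₃ (lam 2) (Literature.Computability.AlgebraicComplexity.kroneckerPow t₁ n))) ≠ 0 → ∃ (k : ℕ) (mu : Fin 3 → Nat.Partition (k * n)), 0 < k ∧ (∀ j, (mu j).parts = (lam j).parts.map (fun p => k * p)) ∧ Literature.Computability.AlgebraicComplexity.isotypicSum₁ (mu 0) (Literature.Computability.AlgebraicComplexity.isotypicSum₂ (mu 1) (Literature.Computability.AlgebraicComplexity.isotypicSum₃ (mu 2) (Literature.Computability.AlgebraicComplexity.kroneckerPow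 t (k * n)))) ≠ 0) ∧ Literature.Computability.AlgebraicComplexity.AsympLe (fun x y : Literature.Computability.AlgebraicComplexity.TensorClass ℂ => x ≤ y) (Literature.Computability.AlgebraicComplexity.TensorClass.mk s₁) (Literature.Computability.AlgebraicComplexity.TensorClass.mk t₁) := by
  sorry

open Literature.Computability.AlgebraicComplexity

/-- **Composition**: invariance on the fibres of `Δ` and lifting of domination to `≲` between twins
give monotonicity of every universal spectral point under polytope inclusion — the crux BY NAME,
from the two declared stubs (the only `sorry`s of the file). -/
theorem PolytopeSaturation_of : PolytopeSaturation := by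
  have h₁ := stub_polytopeInvariance
  have h₂ := @stub_dominationLifting
  intro F hF ι κ μ ι' κ' μ' _ _ _ _ _ _ s t hdom
  -- lift `Δ(s) ⊆ Δ(t)` to `[s₁] ≲ [t₁]` in `T(ℂ)` for polytope-twins `s₁` of `s` and `t₁` of `t`
  obtain ⟨ι₁, κ₁, μ₁, ι₂, κ₂, μ₂, _, _, _, _, _, _, s₁, t₁, hss₁, hs₁s, htt₁, ht₁t, f, hf, hle⟩ :=
    h₂ s t hdom
  -- (1) `F` is constant on the two fibres
  have es : F s = F s₁ := h₁ F hF s s₁ hss₁ hs₁s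
  have et : F t₁ = F t := (h₁ F hF t t₁ htt₁ ht₁t).symm
  -- (2) Strassen, easy half: `[s₁]^N ≤ f(N)·[t₁]^N` with `f` subexponential forces `F s₁ ≤ F t₁`,
  --     reading the inequality through the monotone semiring homomorphism `eval F : T(ℂ) → ℝ`
  have hφ := TensorClass.isSpectralPoint_eval (K := ℂ) hF
  have key : F s₁ ≤ F t₁ := by
    refine hf.le_of_pow_le (hF.nonneg t₁) fun N _ => ?_
    have hN := hφ.mono (hle N)
    rw [hφ.map_pow, hφ.map_mul, hφ.map_natCast, hφ.map_pow,
      TensorClass.eval_mk hF, TensorClass.eval_mk hF] at hN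
    exact hN
  calc F s = F s₁ := es
    _ ≤ F t₁ := key
    _ = F t := et

/-- Converse 1: `PolytopeSaturation` implies stub 1. -/
theorem polytopeInvariance_of_polytopeSaturation (h : PolytopeSaturation) :
    ∀ F : Literature.Computability.AlgebraicComplexity.SpectralMap ℂ, Literature.Computability.AlgebraicComplexity.IsUniversalSpectralPoint ℂ F → ∀ {ι κ μ ι' κ' μ' : Type} [Fintype ι] [Fintype κ] [Fintype μ] [Fintype ι'] [Fintype κ'] [Fintype μ'] (s : ι → κ → μ → ℂ) (t : ι' → κ' → μ' → ℂ), (∀ (n : ℕ) (lam : Fin 3 → Nat.Partition n), 0 < n → Literature.Computability.AlgebraicComplexity.isotypicSum₁ (lam 0) (Literature.Computability.AlgebraicComplexity.isotypicSum₂ (lam 1) (Literature.Computability.AlgebraicComplexity.isotypicSum₃ (lam 2) (Literature.Computability.AlgebraicComplexity.kroneckerPow s n))) ≠ 0 → ∃ (k : ℕ) (mu : Fin 3 → Nat.Partition (k * n)), 0 < k ∧ (∀ j, (mu j).parts = (lam j).parts.map (fun p => k * p)) ∧ Literature.Computability.AlgebraicComplexity.isotypicSum₁ (mu 0) (Literature.Computability.AlgebraicComplexity.isotypicSum₂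 (mu 1) (Literature.Computability.AlgebraicComplexity.isotypicSum₃ (mu 2) (Literature.Computability.AlgebraicComplexity.kroneckerPow t (k * n)))) ≠ 0) → (∀ (n : ℕ) (lam : Fin 3 → Nat.Partition n), 0 < n → Literature.Computability.AlgebraicComplexity.isotypicSum₁ (lam 0) (Literature.Computability.AlgebraicComplexity.isotypicSum₂ (lam 1) (Literature.Computability.AlgebraicComplexity.isotypicSum₃ (lam 2) (Literature.Computability.AlgebraicComplexity.kroneckerPow t n))) ≠ 0 → ∃ (k : ℕ) (mu : Fin 3 → Nat.Partition (k * n)), 0 < k ∧ (∀ j, (mu j).parts = (lam j).parts.map (fun p => k * p)) ∧ Literature.Computability.AlgebraicComplexity.isotypicSum₁ (mu 0) (Literature.Computability.AlgebraicComplexity.isotypicSum₂ (mu 1) (Literature.Computability.AlgebraicComplexity.isotypicSum₃ (mu 2) (Literature.Computability.AlgebraicComplexity.kroneckerPow s (k * n)))) ≠ 0) → F s = F t := by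
  intro F hF ι κ μ ι' κ' μ' _ _ _ _ _ _ s t hst hts
  exact le_antisymm (h F hF s t hst) (h F hF t s hts)

/-- Domination is reflexive (`k = 1`, scaling lemma of the tree). -/
theorem dominated_refl {ι κ μ : Type} [Fintype ι] [Fintype κ] [Fintype μ] (s : ι → κ → μ → ℂ) :
    ∀ (n : ℕ) (lam : Fin 3 → Nat.Partition n), 0 < n →
      isotypicSum₁ (lam 0) (isotypicSum₂ (lam 1) (isotypicSum₃ (lam 2) (kroneckerPow s n))) ≠ 0 →
      ∃ (k : ℕ) (mu : Fin 3 → Nat.Partition (k * n)), 0 < k ∧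
        (∀ j, (mu j).parts = (lam j).parts.map (fun p => k * p)) ∧
        isotypicSum₁ (mu 0) (isotypicSum₂ (mu 1) (isotypicSum₃ (mu 2) (kroneckerPow s (k * n)))) ≠ 0 := by
  intro n lam hn h
  obtain ⟨mu, hmu, hocc⟩ := exists_isotypicSum₁₂₃_kroneckerPow_mul_ne_zero h one_pos
  exact ⟨1, mu, one_pos, hmu, hocc⟩

/-- Converse 2: `PolytopeSaturation` implies stub 2, with the twins `s₁ := s`, `t₁ := t`, by the HARD
half of Strassen's spectral theorem on `T(ℂ)` (tree: `asympLe_of_forall_spectralPoint`) and the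
correspondence spectral points of `T(ℂ)` ↔ universal spectral points (`spectralMapOf`). -/
theorem dominationLifting_of_polytopeSaturation (h : PolytopeSaturation) :
    ∀ {ι κ μ ι' κ' μ' : Type} [Fintype ι] [Fintype κ] [Fintype μ] [Fintype ι'] [Fintype κ'] [Fintype μ'] (s : ι → κ → μ → ℂ) (t : ι' → κ' → μ' → ℂ), (∀ (n : ℕ) (lam : Fin 3 → Nat.Partition n), 0 < n → Literature.Computability.AlgebraicComplexity.isotypicSum₁ (lam 0) (Literature.Computability.AlgebraicComplexity.isotypicSum₂ (lam 1) (Literature.Computability.AlgebraicComplexity.isotypicSum₃ (lam 2) (Literature.Computability.AlgebraicComplexity.kroneckerPow s n))) ≠ 0 → ∃ (k : ℕ) (mu : Fin 3 → Nat.Partition (k * n)), 0 < k ∧ (∀ j, (mu j).parts = (lam j).parts.map (fun p => k * p)) ∧ Literature.Computability.AlgebraicComplexity.isotypicSum₁ (mu 0) (Literature.Computability.AlgebraicComplexity.isotypicSum₂ (mu 1) (Literature.Computability.AlgebraicComplexity.isotypicSum₃ (mu 2) (Literature.Computability.AlgebraicComplexity.kroneckerPow t (k * n)))) ≠ 0)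 → ∃ (ι₁ κ₁ μ₁ ι₂ κ₂ μ₂ : Type) (_ : Fintype ι₁) (_ : Fintype κ₁) (_ : Fintype μ₁) (_ : Fintype ι₂) (_ : Fintype κ₂) (_ : Fintype μ₂) (s₁ : ι₁ → κ₁ → μ₁ → ℂ) (t₁ : ι₂ → κ₂ → μ₂ → ℂ), (∀ (n : ℕ) (lam : Fin 3 → Nat.Partition n), 0 < n → Literature.Computability.AlgebraicComplexity.isotypicSum₁ (lam 0) (Literature.Computability.AlgebraicComplexity.isotypicSum₂ (lam 1) (Literature.Computability.AlgebraicComplexity.isotypicSum₃ (lam 2) (Literature.Computability.AlgebraicComplexity.kroneckerPow s n))) ≠ 0 → ∃ (k : ℕ) (mu : Fin 3 → Nat.Partition (k * n)), 0 < k ∧ (∀ j, (mu j).parts = (lam j).parts.map (fun p => k * p)) ∧ Literature.Computability.AlgebraicComplexity.isotypicSum₁ (mu 0) (Literature.Computability.AlgebraicComplexity.isotypicSum₂ (mu 1) (Literature.Computability.AlgebraicComplexity.isotypicSum₃ (mu 2) (Literature.Computability.AlgebraicComplexity.kroneckerPow s₁ (k * n)))) ≠ 0) ∧ (∀ (n :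 ℕ) (lam : Fin 3 → Nat.Partition n), 0 < n → Literature.Computability.AlgebraicComplexity.isotypicSum₁ (lam 0) (Literature.Computability.AlgebraicComplexity.isotypicSum₂ (lam 1) (Literature.Computability.AlgebraicComplexity.isotypicSum₃ (lam 2) (Literature.Computability.AlgebraicComplexity.kroneckerPow s₁ n))) ≠ 0 → ∃ (k : ℕ) (mu : Fin 3 → Nat.Partition (k * n)), 0 < k ∧ (∀ j, (mu j).parts = (lam j).parts.map (fun p => k * p)) ∧ Literature.Computability.AlgebraicComplexity.isotypicSum₁ (mu 0) (Literature.Computability.AlgebraicComplexity.isotypicSum₂ (mu 1) (Literature.Computability.AlgebraicComplexity.isotypicSum₃ (mu 2) (Literature.Computability.AlgebraicComplexity.kroneckerPow s (k * n)))) ≠ 0) ∧ (∀ (n : ℕ) (lam : Fin 3 → Nat.Partition n), 0 < n → Literature.Computability.AlgebraicComplexity.isotypicSum₁ (lam 0) (Literature.Computability.AlgebraicComplexity.isotypicSum₂ (lam 1) (Literature.Computability.AlgebraicComplexity.isotypicSum₃ (lam 2) (Literature.Computability.AlgebraicComplexity.kroneckerPow t n))) ≠ 0 → ∃ (k : ℕ)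 (mu : Fin 3 → Nat.Partition (k * n)), 0 < k ∧ (∀ j, (mu j).parts = (lam j).parts.map (fun p => k * p)) ∧ Literature.Computability.AlgebraicComplexity.isotypicSum₁ (mu 0) (Literature.Computability.AlgebraicComplexity.isotypicSum₂ (mu 1) (Literature.Computability.AlgebraicComplexity.isotypicSum₃ (mu 2) (Literature.Computability.AlgebraicComplexity.kroneckerPow t₁ (k * n)))) ≠ 0) ∧ (∀ (n : ℕ) (lam : Fin 3 → Nat.Partition n), 0 < n → Literature.Computability.AlgebraicComplexity.isotypicSum₁ (lam 0) (Literature.Computability.AlgebraicComplexity.isotypicSum₂ (lam 1) (Literature.Computability.AlgebraicComplexity.isotypicSum₃ (lam 2) (Literature.Computability.AlgebraicComplexity.kroneckerPow t₁ n))) ≠ 0 → ∃ (k : ℕ) (mu : Fin 3 → Nat.Partition (k * n)), 0 < k ∧ (∀ j, (mu j).parts = (lam j).parts.map (fun p => k * p)) ∧ Literature.Computability.AlgebraicComplexity.isotypicSum₁ (mu 0) (Literature.Computability.AlgebraicComplexity.isotypicSum₂ (mu 1) (Literature.Computability.AlgebraicComplexity.isotypicSum₃ (mu 2) (Literature.Computability.AlgebraicComplexity.kroneckerPow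 t (k * n)))) ≠ 0) ∧ Literature.Computability.AlgebraicComplexity.AsympLe (fun x y : Literature.Computability.AlgebraicComplexity.TensorClass ℂ => x ≤ y) (Literature.Computability.AlgebraicComplexity.TensorClass.mk s₁) (Literature.Computability.AlgebraicComplexity.TensorClass.mk t₁) := by
  intro ι κ μ ι' κ' μ' _ _ _ _ _ _ s t hdom
  refine ⟨ι, κ, μ, ι', κ', μ', inferInstance, inferInstance, inferInstance, inferInstance,
    inferInstance, inferInstance, s, t, dominated_refl s, dominated_refl s, dominated_refl t,
    dominated_refl t, ?_⟩
  refine (TensorClass.isStrassenPreorder ℂ).asympLe_of_forall_spectralPoint _ _ fun φ hφ => ?_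
  have hF := TensorClass.isUniversalSpectralPoint_spectralMapOf hφ
  have := h _ hF s t hdom
  rwa [TensorClass.spectralMapOf_apply, TensorClass.spectralMapOf_apply] at this

end Summit.MatrixMultiplication.MatrixMultiplication.Cruxes.PolytopeSaturation.KernelImageSplit
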